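import Summits.Ventures.PercRepro.SeriesParallelC005
import Summits.Ventures.PercRepro.C026PendantA

/-!
# C-005 under series–parallel–PENDANT reduction

`SeriesParallelC005.lean` transports C-005 backwards along series steps at unmarked vertices and
parallel steps. A third kind of step costs nothing more: an edge at a PENDANT unmarked vertex `v`
(p5's `Pendant v w`, `C026PendantA.lean`: every edge at `v` joins `v` and `w`) never affects the
connectivity of vertices other than `v` (`conn_closeStar_iff`), so it may be killed (weight `0`)
without changing any partition probability of the four marks
(`prob_partitionEvent_update_zero_of_pendant`; the flip argument is p6's, `C026SeriesParallel`).
`C005At_of_reducesP`: C-005 at every `p` for every marked multigraph that series–parallel–pendant-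
reduces to at most eight live edges — pendant trees at unmarked vertices come for free.
-/

namespace PercRepro

namespace MultiGraph

variable {V E : Type} [Fintype E] [DecidableEq E]

omit [Fintype E] in
/-- Flipping an edge at a pendant vertex does not change the closed star at that vertex. -/
theorem closeStar_flipEdge' {G : MultiGraph V E} (v : V) {f : E} (hf : f ∈ G.edgesAt ({v} : Set V))
    (ω : Config E) : G.closeStar v (PercRepro.flipEdge f ω) = G.closeStar v ω := by
  ext e
  by_cases he : e ∈ G.edgesAt ({v} : Set V)
  · rw [G.closeStar_apply_of_mem he, G.closeStar_apply_of_mem he]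
  · have hef : e ≠ f := fun h => he (h ▸ hf)
    rw [G.closeStar_apply_of_notMem he, G.closeStar_apply_of_notMem he, PercRepro.flipEdge,
      Function.update_of_ne hef]

omit [Fintype E] in
/-- Connectivity between vertices other than a pendant vertex `v` ignores the edges at `v`. -/
theorem conn_flipEdge_iff_of_pendant' {G : MultiGraph V E} {v w : V} (hp : G.Pendant v w)
    (hvw : v ≠ w) {f : E} (hf : f ∈ G.edgesAt ({v} : Set V)) (ω : Config E) {x y : V} (hx : x ≠ v)
    (hy : y ≠ v) : G.Conn (PercRepro.flipEdge f ω) x y ↔ G.Conn ω x y := by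
  rw [G.conn_closeStar_iff hp hvw hx hy, closeStar_flipEdge' v hf,
    ← G.conn_closeStar_iff hp hvw hx hy]

/-- **An edge at a pendant unmarked vertex may be killed**: the partition probabilities of marks
avoiding `v` are unchanged when an edge at the pendant vertex `v` gets weight `0`. -/
theorem prob_partitionEvent_update_zero_of_pendant' {G : MultiGraph V E} {v w : V}
    (hp : G.Pendant v w) (hvw : v ≠ w) {f : E} (hf : f ∈ G.edgesAt ({v} : Set V)) (p : E → ℝ)
    {k : ℕ} {m : Fin k → V} (hm : ∀ i, m i ≠ v) (rgs : Fin k → ℕ) :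
    prob p (G.partitionEvent m rgs) = prob (Function.update p f 0) (G.partitionEvent m rgs) := by
  have hinv : PercRepro.flipEdge f ⁻¹' G.partitionEvent m rgs = G.partitionEvent m rgs := by
    ext ω
    show PercRepro.flipEdge f ω ∈ G.partitionEvent m rgs ↔ ω ∈ G.partitionEvent m rgs
    simp only [partitionEvent, Set.mem_setOf_eq]
    exact forall_congr' fun i => forall_congr' fun j => by
      rw [G.conn_flipEdge_iff_of_pendant' hp hvw hf ω (hm i) (hm j)]
  rw [prob_split p f, prob_update_zero_eq_prob_update_one_preimage p f, hinv]
  ring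

/-- **A series–parallel–pendant reduction step**: a series pair at an unmarked vertex, a parallel
pair, or an edge at a pendant unmarked vertex (killed). -/
inductive SPPStep (a b c d : V) : MultiGraph V E × (E → ℝ) → MultiGraph V E × (E → ℝ) → Prop
  | sp {x y : MultiGraph V E × (E → ℝ)} (h : SPStep a b c d x y) : SPPStep a b c d x y
  | pendant {G : MultiGraph V E} {p : E → ℝ} {v w : V} (hp : G.Pendant v w) (hvw : v ≠ w)
      (hv : v ≠ a ∧ v ≠ b ∧ v ≠ c ∧ v ≠ d) {f : E} (hf : f ∈ G.edgesAt ({v} : Set V)) :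
      SPPStep a b c d (G, p) (G, Function.update p f 0)

/-- **Series–parallel–pendant reduction**: the reflexive–transitive closure of the steps. -/
def ReducesP (a b c d : V) : MultiGraph V E × (E → ℝ) → MultiGraph V E × (E → ℝ) → Prop :=
  Relation.ReflTransGen (SPPStep a b c d)

omit [Fintype E] in
/-- A step preserves probability vectors. -/
theorem SPPStep.isProb {a b c d : V} {x y : MultiGraph V E × (E → ℝ)} (h : SPPStep a b c d x y)
    (hp : IsProb x.2) : IsProb y.2 := by
  cases h with
  | sp h => exact h.isProb hp
  | @pendant G p v w _ _ _ f _ =>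
    intro e
    by_cases he : e = f
    · subst he
      show 0 ≤ Function.update p e 0 e ∧ Function.update p e 0 e ≤ 1
      rw [Function.update_self]
      exact ⟨le_rfl, zero_le_one⟩
    · show 0 ≤ Function.update p f 0 e ∧ Function.update p f 0 e ≤ 1
      rw [Function.update_of_ne he]
      exact hp e

omit [Fintype E] in
/-- A reduction preserves probability vectors. -/
theorem ReducesP.isProb {a b c d : V} {x y : MultiGraph V E × (E → ℝ)} (h : ReducesP a b c d x y)
    (hp : IsProb x.2) : IsProb y.2 := by
  induction h with
  | refl => exact hp
  | tail _ hstep ih => exact hstep.isProb ih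

/-- **C-005 transports backwards along a series–parallel–pendant step.** -/
theorem C005At_of_sppStep {a b c d : V} {x y : MultiGraph V E × (E → ℝ)} (h : SPPStep a b c d x y)
    (hy : y.1.C005At y.2 a b c d) : x.1.C005At x.2 a b c d := by
  cases h with
  | sp h => exact C005At_of_step h hy
  | @pendant G p v w hpv hvw hv f hf =>
    unfold C005At at hy ⊢
    have hm := marks_ne_of_ne hv
    rw [G.prob_partitionEvent_update_zero_of_pendant' hpv hvw hf p hm ![0, 0, 1, 1],
      G.prob_partitionEvent_update_zero_of_pendant' hpv hvw hf p hm ![0, 1, 0, 1],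
      G.prob_partitionEvent_update_zero_of_pendant' hpv hvw hf p hm ![0, 1, 1, 0],
      G.prob_partitionEvent_update_zero_of_pendant' hpv hvw hf p hm ![0, 0, 0, 0],
      G.prob_partitionEvent_update_zero_of_pendant' hpv hvw hf p hm ![0, 1, 2, 3]]
    exact hy

/-- **C-005 transports backwards along a series–parallel–pendant reduction.** -/
theorem C005At_of_reducesP' {a b c d : V} {x y : MultiGraph V E × (E → ℝ)}
    (h : ReducesP a b c d x y) (hy : y.1.C005At y.2 a b c d) : x.1.C005At x.2 a b c d := by
  induction h using Relation.ReflTransGen.head_induction_on with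
  | refl => exact hy
  | head hstep _ ih => exact C005At_of_sppStep hstep ih

/-- **C-005 for every instance that series–parallel–pendant-reduces to at most eight live edges.** -/
theorem C005At_of_reducesP {a b c d : V} {G G' : MultiGraph V E} {p p' : E → ℝ} (hp : IsProb p)
    (h : ReducesP a b c d (G, p) (G', p')) (hlive : (liveEdges p').card ≤ 8) :
    G.C005At p a b c d :=
  C005At_of_reducesP' h (G'.C005At_of_card_liveEdges_le_eight (h.isProb hp) hlive a b c d)

end MultiGraph

end PercRepro
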